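import Summits.CriticalPhenomena.PercolationContinuityZ3.Theorems.Transplant.FKConnectivityAllQTwoClusterRayleighSquare
import Summits.CriticalPhenomena.PercolationContinuityZ3.Theorems.Transplant.FKConnectivityAllQArborealDefs
import HarnessLib

/-!
# ADJACENT-pair coefficientwise Rayleigh monotonicity of spanning FORESTS (node `ForestAdjRayleighPos`, NOT asserted) — the lowest
# `q`-slice of the two-cluster Conjecture R_q — and its kernel consequence: adjacent edges are NEGATIVELY CORRELATED under the arboreal gas
# (weighted spanning-forest measure `agMeasure w`) on every finite weighted graph, with the Cibulka–Hladký–LaCroix–Wagner square term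

Support file (`--supports stmt-CriticalPhenomena-4575`), FK sub-lane `prim-bschramm-fk-1` (gen 16) of the post-continuity programme;
builds on p205010 (kernel theorem, internal audit signed; external expert review pending).  Definitions (two events, one counting
predicate, one `@[conjecture]` node — NOT asserted), no named facts, no sorries; standard axioms.

THE STATEMENT (memo bschramm/FROM-fk-1-g16-FOREST-SLICE.md §1).  For a finite graph and two ADJACENT edges `e = ov`, `f = oy` let
`F = Σ_forests x^F` be the spanning-forest polynomial (all forests, any number of trees) and `X` the polynomial of the forests `ξ` of
`G ∖ {e,f}` with `o ∤ v`, `o ∤ y`, `v ~ y` (CHLW's class `X⁻`; `X⁺ = ∅` for an adjacent pair).  Then, conjecturally,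
**`F_e F_f − F_{ef} F − x_e x_f X² = x_e x_f (F_e^f F_f^e − F_{ef} F^{ef} − X²)` has NONNEGATIVE COEFFICIENTS.**  In pattern form: for every
finite (multi)graph `H` and distinct `o, v, y`, `N(0,OVY) ≤ N(OV,OY) + N(OY,VY) + N(VY,OV) + N(0,VY)`, `N(π,π')` = number of ordered
partitions of `E(H)` into two forests inducing the partitions `π, π'` of `{o,v,y}`.  At tree level (`|E| = 2|V| − 4`) this is
Cibulka–Hladký–LaCroix–Wagner's IDENTITY `T_e^f T_f^e − T_{ef}T^{ef} = (X⁺ − X⁻)²` (coefficientwise, equality); below tree level it is an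
inequality.  Fibre form (node `ForestAdjRayleighOn V`, all pairs of `Sym2 V` weighted, `Fo` = forest configurations, `J_g = {g ∈ ω}`,
`𝒳 = xMinusEv o v y`): for every folding fibre `(M, u₀)`,
`#(Fo ∩ J_e ∩ J_f, Fo) + #({e ∈ ω, ω∖{e} ∈ 𝒳}, {f ∈ ω, ω∖{f} ∈ 𝒳}) ≤ #(Fo ∩ J_e, Fo ∩ J_f)`.
WHY IT IS HERE.  (i) It is EXACTLY the lowest `q`-slice (`s = 2|V| − |M| − 2` in the full-bipartition fibre) of the lineage's Conjecture R_q
(`TwoClusterRayleighGradedOn`, fk-1 g16): there both configurations `T + e`, `Tᶜ + f` must be forests with `a ↮ c`, i.e. forests of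
`H/{a=c}` in which `e, f` become adjacent at the merged vertex (checked pair-by-pair: memo §1, numerics/slicecheck.py 137/137); so R_q is
at least as strong as this statement.  (ii) For NON-adjacent pairs the coefficientwise inequality is FALSE already on `K₄` (two disjoint
edges: full-bipartition coefficient `2 − 4 < 0`), which is Semple–Welsh's Thm. 4.2 ("a binary matroid is strongly independence-correlated iff
it has no `M(K₄)` minor"); adjacency is not a matroid notion, and the adjacent case is not in print as searched (it implies the ADJACENT case
of the Grimmett–Winkler / Pemantle / Kahn edge-negative-correlation conjecture for uniform forests, Semple–Welsh Conj. 1.1, open since the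
early 1990s).  (iii) EVIDENCE (fk-1 g16, exact, numerics/fpat.c): 0 failures on ALL simple graphs with ≤ 7 vertices (n = 7: 831,288
graphs, 174,570,480 placements `(H; o,v,y)`; n ≤ 6: 3,204,480), all multigraphs with ≤ 6 vertices, multiplicity ≤ 2, ≤ 9 edges
(50,355,120 placements); ≈ 90 % of placements are tight; 2,300 random general fibres n ≤ 6 (numerics/fibrecheck.py).
KERNEL.  **`real_forest_sq_ineq_of_forestAdj`**: the node gives, for every weight vector,
`P(Fo ∩ J_e ∩ J_f)·P(Fo) + P(𝒳_e)·P(𝒳_f) ≤ P(Fo ∩ J_e)·P(Fo ∩ J_f)` (`P = prodBernoulli w`, folding fibres); since the arboreal gas is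
`agMeasure w = P_w( · | Fo)` (`agMeasure_real_mul_agPartition`), **`ag_adjacent_negCorr_of_forestAdj`**:
`μ(J_e ∩ J_f)·μ(Ω) + μ(𝒳_e)·μ(𝒳_f) ≤ μ(J_e)·μ(J_f)` for `μ = agMeasure w`, every `w` — adjacent edges of the arboreal gas / weighted uniform
forest are negatively correlated on every finite graph, with the square term, IF the node holds.  Nothing is asserted.
[cite: CibulkaHladkyLaCroixWagner2008, Thm. 1 (p. 2)] [cite: SempleWelsh2008, Conj. 1.1 (p. 2); Thm. 4.2 (p. 11)]
[cite: Grimmett2006, §1.5 eq. (1.22), Thm. (1.23) (pp. 13–14); §3.9 (pp. 63–65)] [cite: Linusson2011, Prop. 2.6]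
-/

noncomputable section

namespace Summit.CriticalPhenomena.PercolationContinuityZ3.Theorems

namespace FK

open MeasureTheory Set Literature.Probability.LatticeModels Literature.Probability.Percolation
open Literature.Probability.Percolation.BHK2006 (weight weight_nonneg ind_inter)
open Literature.Probability.Percolation.DecisionTree (ind ind_of_mem ind_of_not_mem ind_nonneg)
open scoped Classical symmDiff

variable {V : Type*} [Fintype V]

/-! ### Forest events -/

/-- **The forest event** `Fo` (loop-free acyclic configurations). [cite: Grimmett2006, §1.5 eq. (1.22) (p. 13)] -/
def forestEv (V : Type*) : Set (BondConfig V) := {ω | IsForestCfg ω}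

/-- **CHLW's class `X⁻` for the adjacent pair `ov, oy`**: forests with `o ∤ v`, `o ∤ y`, `v ~ y` (so `ov, oy ∉ ω`, and adding both
creates the cycle `o v … y o`). [cite: CibulkaHladkyLaCroixWagner2008, Thm. 1 (p. 2)] -/
def xMinusEv (o v y : V) : Set (BondConfig V) :=
  {ω | IsForestCfg ω ∧ ¬ (openGraph ω).Reachable o v ∧ ¬ (openGraph ω).Reachable o y ∧ (openGraph ω).Reachable v y}

/-! ### The node -/

/-- **Adjacent-pair coefficientwise forest Rayleigh on the vertex type `V`** (fibre form, with the square): for every fibre `(M, u₀)` and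
all `o, v, y`, with `e = ov`, `f = oy`,
`#(Fo ∩ J_e ∩ J_f, Fo) + #({e ∈ ω, ω ∖ {e} ∈ 𝒳}, {f ∈ ω, ω ∖ {f} ∈ 𝒳}) ≤ #(Fo ∩ J_e, Fo ∩ J_f)`.
[cite: CibulkaHladkyLaCroixWagner2008, Thm. 1 (p. 2)] [cite: SempleWelsh2008, Conj. 1.1 (p. 2)] [cite: Linusson2011, Prop. 2.6] -/
def ForestAdjRayleighOn (V : Type*) [Fintype V] : Prop :=
  ∀ (M u₀ : BondConfig V), Disjoint u₀ M → ∀ (o v y : V),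
    fibreCount M u₀ (forestEv V ∩ {ω | s(o, v) ∈ ω ∧ s(o, y) ∈ ω}) (forestEv V) +
      fibreCount M u₀ {ω | s(o, v) ∈ ω ∧ ω \ {s(o, v)} ∈ xMinusEv o v y} {ω | s(o, y) ∈ ω ∧ ω \ {s(o, y)} ∈ xMinusEv o v y} ≤
      fibreCount M u₀ (forestEv V ∩ {ω | s(o, v) ∈ ω}) (forestEv V ∩ {ω | s(o, y) ∈ ω})

/-- **Adjacent-pair coefficientwise forest Rayleigh on every finite vertex type.**  CONJECTURE-SHAPED COUNTING STATEMENT, NOT asserted.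
The lowest `q`-slice of `TwoClusterRayleighGradedPos`; false for non-adjacent pairs (K₄, Semple–Welsh Thm. 4.2); census: 0 failures on all
graphs with ≤ 7 vertices (1.7·10⁸ placements) and all multigraphs with ≤ 6 vertices, multiplicity ≤ 2, ≤ 9 edges (5.0·10⁷).
[cite: CibulkaHladkyLaCroixWagner2008, Thm. 1 (p. 2)] [cite: SempleWelsh2008, Conj. 1.1 (p. 2); Thm. 4.2 (p. 11)] -/
@[conjecture] def ForestAdjRayleighPos : Prop := ∀ n : ℕ, ForestAdjRayleighOn (Fin n)

/-! ### The arboreal gas is product measure conditioned on the forest event -/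

/-- The arboreal weight is the product weight times the indicator of the forest event. [cite: Grimmett2006, §1.5 eq. (1.22) (p. 13)] -/
theorem agWeight_eq_weight_mul_ind (w : Sym2 V → unitInterval) (ω : BondConfig V) :
    agWeight w ω = weight (fun e => ((w e : unitInterval) : ℝ)) ω * ind (forestEv V) ω := by
  by_cases h : IsForestCfg ω
  · rw [agWeight_of_isForestCfg w h, ind_of_mem (show ω ∈ forestEv V from h), mul_one]
  · rw [agWeight_of_not_isForestCfg w h, ind_of_not_mem (show ω ∉ forestEv V from h), mul_zero]

/-- **`Z_for = P_w(Fo)`.** [cite: Grimmett2006, §1.5 eq. (1.22) (p. 13)] -/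
theorem agPartition_eq_real_forestEv (w : Sym2 V → unitInterval) : agPartition w = (prodBernoulli w).real (forestEv V) := by
  unfold agPartition
  rw [prodBernoulli_real_eq_sum_weight_ind]
  exact Finset.sum_congr rfl fun ω _ => agWeight_eq_weight_mul_ind w ω

/-- **`μ_for(A)·Z_for = P_w(A ∩ Fo)`** (also when `Z_for = 0`, both sides vanishing). [cite: Grimmett2006, §1.5 eq. (1.22) (p. 13)] -/
theorem agMeasure_real_mul_agPartition (w : Sym2 V → unitInterval) (A : Set (BondConfig V)) :
    (agMeasure w).real A * agPartition w = (prodBernoulli w).real (A ∩ forestEv V) := by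
  by_cases hZ : agPartition w = 0
  · rw [hZ, mul_zero]
    have hle : (prodBernoulli w).real (A ∩ forestEv V) ≤ (prodBernoulli w).real (forestEv V) := measureReal_mono inter_subset_right
    rw [← agPartition_eq_real_forestEv, hZ] at hle
    exact le_antisymm measureReal_nonneg hle
  · rw [agMeasure_real_eq_sum, prodBernoulli_real_eq_sum_weight_ind, Finset.sum_mul]
    refine Finset.sum_congr rfl fun ω _ => ?_
    unfold agMass
    rw [agWeight_eq_weight_mul_ind, ind_inter]
    field_simp

/-! ### The node gives the square inequality for product measure and for the arboreal gas -/

/-- **Node ⇒ `P(Fo ∩ J_e ∩ J_f)·P(Fo) + P(𝒳_e)·P(𝒳_f) ≤ P(Fo ∩ J_e)·P(Fo ∩ J_f)`** for `P = prodBernoulli w`, every `w` (folding fibres).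
[cite: Linusson2011, Prop. 2.6] [cite: CibulkaHladkyLaCroixWagner2008, Thm. 1 (p. 2)] -/
theorem real_forest_sq_ineq_of_forestAdj (h : ForestAdjRayleighOn V) (w : Sym2 V → unitInterval) (o v y : V) :
    (prodBernoulli w).real (forestEv V ∩ {ω | s(o, v) ∈ ω ∧ s(o, y) ∈ ω}) * (prodBernoulli w).real (forestEv V) +
      (prodBernoulli w).real {ω | s(o, v) ∈ ω ∧ ω \ {s(o, v)} ∈ xMinusEv o v y} *
        (prodBernoulli w).real {ω | s(o, y) ∈ ω ∧ ω \ {s(o, y)} ∈ xMinusEv o v y} ≤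
      (prodBernoulli w).real (forestEv V ∩ {ω | s(o, v) ∈ ω}) * (prodBernoulli w).real (forestEv V ∩ {ω | s(o, y) ∈ ω}) :=
  real_mul_add_mul_le_of_fibrewise_pos w _ _ _ _ _ _ fun M u₀ hd _ => h M u₀ hd o v y

/-- **Node ⇒ adjacent edges are negatively correlated under the arboreal gas, with the square term**:
`μ(J_e ∩ J_f)·μ(Ω) + μ(𝒳_e)·μ(𝒳_f) ≤ μ(J_e)·μ(J_f)`, `μ = agMeasure w`, `e = ov`, `f = oy`, every `w`.
[cite: Grimmett2006, §1.5 eq. (1.22), Thm. (1.23) (pp. 13–14); §3.9 (pp. 63–65)] [cite: SempleWelsh2008, Conj. 1.1 (p. 2)] -/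
theorem ag_adjacent_negCorr_of_forestAdj (h : ForestAdjRayleighOn V) (w : Sym2 V → unitInterval) (o v y : V) :
    (agMeasure w).real {ω | s(o, v) ∈ ω ∧ s(o, y) ∈ ω} * (agMeasure w).real univ +
      (agMeasure w).real {ω | s(o, v) ∈ ω ∧ ω \ {s(o, v)} ∈ xMinusEv o v y} *
        (agMeasure w).real {ω | s(o, y) ∈ ω ∧ ω \ {s(o, y)} ∈ xMinusEv o v y} ≤
      (agMeasure w).real {ω | s(o, v) ∈ ω} * (agMeasure w).real {ω | s(o, y) ∈ ω} := by
  by_cases hZ : agPartition w = 0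
  · -- degenerate parameters: the arboreal gas is the zero measure
    have h0 : ∀ A : Set (BondConfig V), (agMeasure w).real A = 0 := by
      intro A
      rw [agMeasure_real_eq_sum]
      refine Finset.sum_eq_zero fun ω _ => ?_
      unfold agMass; rw [hZ, div_zero, zero_mul]
    simp only [h0, mul_zero, zero_add, le_refl]
  · have hZpos : 0 < agPartition w := lt_of_le_of_ne (agPartition_nonneg w) (Ne.symm hZ)
    rw [← mul_le_mul_iff_of_pos_right (mul_pos hZpos hZpos)]
    have key := real_forest_sq_ineq_of_forestAdj h w o v y
    have e1 := agMeasure_real_mul_agPartition w {ω | s(o, v) ∈ ω ∧ s(o, y) ∈ ω}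
    have e2 := agMeasure_real_mul_agPartition w (univ : Set (BondConfig V))
    have e3 := agMeasure_real_mul_agPartition w {ω | s(o, v) ∈ ω ∧ ω \ {s(o, v)} ∈ xMinusEv o v y}
    have e4 := agMeasure_real_mul_agPartition w {ω | s(o, y) ∈ ω ∧ ω \ {s(o, y)} ∈ xMinusEv o v y}
    have e5 := agMeasure_real_mul_agPartition w {ω | s(o, v) ∈ ω}
    have e6 := agMeasure_real_mul_agPartition w {ω | s(o, y) ∈ ω}
    rw [univ_inter] at e2
    calc ((agMeasure w).real {ω | s(o, v) ∈ ω ∧ s(o, y) ∈ ω} * (agMeasure w).real univ +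
          (agMeasure w).real {ω | s(o, v) ∈ ω ∧ ω \ {s(o, v)} ∈ xMinusEv o v y} *
            (agMeasure w).real {ω | s(o, y) ∈ ω ∧ ω \ {s(o, y)} ∈ xMinusEv o v y}) * (agPartition w * agPartition w)
        = ((agMeasure w).real {ω | s(o, v) ∈ ω ∧ s(o, y) ∈ ω} * agPartition w) * ((agMeasure w).real univ * agPartition w) +
          ((agMeasure w).real {ω | s(o, v) ∈ ω ∧ ω \ {s(o, v)} ∈ xMinusEv o v y} * agPartition w) *
            ((agMeasure w).real {ω | s(o, y) ∈ ω ∧ ω \ {s(o, y)} ∈ xMinusEv o v y} * agPartition w) := by ring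
      _ = (prodBernoulli w).real (forestEv V ∩ {ω | s(o, v) ∈ ω ∧ s(o, y) ∈ ω}) * (prodBernoulli w).real (forestEv V) +
          (prodBernoulli w).real ({ω | s(o, v) ∈ ω ∧ ω \ {s(o, v)} ∈ xMinusEv o v y} ∩ forestEv V) *
            (prodBernoulli w).real ({ω | s(o, y) ∈ ω ∧ ω \ {s(o, y)} ∈ xMinusEv o v y} ∩ forestEv V) := by
          rw [e1, e2, e3, e4, inter_comm]
      _ ≤ (prodBernoulli w).real (forestEv V ∩ {ω | s(o, v) ∈ ω ∧ s(o, y) ∈ ω}) * (prodBernoulli w).real (forestEv V) +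
          (prodBernoulli w).real {ω | s(o, v) ∈ ω ∧ ω \ {s(o, v)} ∈ xMinusEv o v y} *
            (prodBernoulli w).real {ω | s(o, y) ∈ ω ∧ ω \ {s(o, y)} ∈ xMinusEv o v y} :=
          add_le_add le_rfl (mul_le_mul (measureReal_mono inter_subset_left (measure_ne_top (prodBernoulli w) _))
            (measureReal_mono inter_subset_left (measure_ne_top (prodBernoulli w) _)) measureReal_nonneg measureReal_nonneg)
      _ ≤ (prodBernoulli w).real (forestEv V ∩ {ω | s(o, v) ∈ ω}) * (prodBernoulli w).real (forestEv V ∩ {ω | s(o, y) ∈ ω}) := key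
      _ = ((agMeasure w).real {ω | s(o, v) ∈ ω} * agPartition w) * ((agMeasure w).real {ω | s(o, y) ∈ ω} * agPartition w) := by
          rw [e5, e6, inter_comm, inter_comm {ω | s(o, y) ∈ ω}]
      _ = (agMeasure w).real {ω | s(o, v) ∈ ω} * (agMeasure w).real {ω | s(o, y) ∈ ω} * (agPartition w * agPartition w) := by ring

end FK

end Summit.CriticalPhenomena.PercolationContinuityZ3.Theorems

end
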